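import Summits.Langlands.Langlands.Theorems.IrreducibilityBySelfDualityIrreducibleOffSectorOfReciprocity
import Summits.Langlands.Langlands.Theorems.IrreducibilityBySelfDualityReciprocityUpToIrreducibilityGeometricConstituents
import Summits.Langlands.Langlands.Theorems.IrreducibilityBySelfDualityReciprocityUpToIrreducibilityDeRhamBlocks
import HarnessLib

/-!
# `IrreducibleOffSector` — the isobaric bootstrap in its POINTWISE WEAK form
(crux stmt-Langlands-14329 `IrreducibilityBySelfDuality.IrreducibleOffSector`, line `Sketch`;
`--supports` file, STRUCTURAL: imports `Summits.Langlands.Langlands.Statement` + landed stub modules +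
Literature only, so that it can be used inside the route's deciding theorem `closes`)

The landed bootstrap `isIrreducible_of_reciprocityUpToIrreducibility` (p103935) derives the crux from
`ReciprocityUpToIrreducibility` (stmt-Langlands-14328): ONE reciprocity datum `Rec`, geometric avatars
with full local–global compatibility for every L-algebraic cuspidal `π` in every rank, and
`GaloisToAutomorphic` in every rank.  The argument uses far less, and this file records exactly what:

**Theorem** (`isIrreducible_of_geometric_of_weakAutomorphyBelow`).  Grant Arthur–Clozel (2.2) and
(2.3) for cuspidal Borel–Jacquet data.  Let `π` be a cuspidal datum on `GL_n(𝔸_K)` (`n ≥ 1`; no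
algebraicity hypothesis), `ι : ℚ̄_ℓ ≃ ℂ`, and suppose
* (W_π) there is ONE `ρ₀ : Γ_K → GL_n(ℚ̄_ℓ)`, unramified almost everywhere and de Rham above `ℓ` for
  Fontaine's pinned datum, Satake–Frobenius compatible with `(π, ι)` at almost all places, and
* (B_w below `n`) for every `0 < m < n`, every IRREDUCIBLE `r : Γ_K → GL_m(ℚ̄_ℓ)` unramified a.e. and
  de Rham above `ℓ` (pinned datum) is Satake–Frobenius compatible a.e. with SOME cuspidal datum on
  `GL_m(𝔸_K)` (weak automorphy: no local–global compatibility, no algebraicity, no uniqueness).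
Then EVERY `ρ : Γ_K → GL_n(ℚ̄_ℓ)` Satake–Frobenius compatible with `(π, ι)` a.e. is irreducible.

So the crux needs from E neither the reciprocity datum nor local–global compatibility: only weak
existence (W) for the `π` at hand and weak automorphy (B_w) strictly below its rank
(`irreducibleOffSector_text_of_weak`: the texts of the 14328 lead's registered stubs
`stub_weakExistence` / `stub_weakAutomorphy` VERBATIM imply the item's text; and in rank `2` only weak
automorphy of pinned-geometric `ℓ`-adic CHARACTERS is used, `isIrreducible_rank_two_of_geometric_of_weakAutomorphy_one`).

**Proof** (Calegari–Gee 2013, §1.1; Ramakrishnan 2008, §0).  The pinned-geometric `ρ₀` has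
irreducible pinned-geometric framed constituents `r_i` of ranks `m_i > 0`, `∑ m_i = n`, with
`det(X - ρ₀ g) = ∏ det(X - r_i g)` (`ReciprocityUpToIrreducibility.exists_geometricConstituents`, fed
with Fontaine's Exp. III Prop. 1.5.2 `ReciprocityUpToIrreducibility.stub_deRhamBlocks`; both landed
by the 14328 lead, p99702/p98936).  If there is one constituent, `ρ₀` is irreducible.  If there are
`k ≥ 2`, each has rank `< n`, so (B_w) attaches a cuspidal `σ_i` on `GL_{m_i}`; multiplicativity and
injectivity of the L-normalised dictionary `arithFrobPolyOfSatake ι q 1` then make the Satake family of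
`π` almost everywhere the union of those of the `σ_i`, which isobaric rigidity forbids
(`isobaricRigidity_of_JS`, Jacquet–Shalika II Thm. 4.4, p102635).  Irreducibility passes from `ρ₀` to
every a.e.-compatible `ρ` by Chebotarev–Brauer–Nesbitt (`isIrreducible_of_satakeFrobCompatible`, p79199).

References: F. Calegari, T. Gee, *Irreducibility of automorphic Galois representations of GL(n), n at
most 5*, Ann. Inst. Fourier 63 (2013), §1.1; D. Ramakrishnan, *Irreducibility and cuspidality*,
Progr. Math. 270 (2008), §0; H. Jacquet, J. Shalika, Amer. J. Math. 103 (1981) II, Thm. 4.4.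
-/

noncomputable section

set_option linter.dupNamespace false

open scoped NumberField Classical Polynomial
open Filter IsDedekindDomain Polynomial
open Literature.NumberTheory.Automorphic Literature.NumberTheory.GaloisRepresentations
open Summit.Langlands

namespace Summit.Langlands.Langlands.Theorems.IrreducibleOffSector

/-- The ranks of framed constituents add up: if `det(X - ρ g) = ∏ᵢ det(X - rᵢ g)` at one `g`, then
`∑ mᵢ = n` (degrees of monic polynomials). [folklore] -/
theorem sum_rank_eq_of_charpoly_eq_prod {K : Type} [Field K] [NumberField K] {ℓ : ℕ} [Fact ℓ.Prime]
    {n k : ℕ} {m : Fin k → ℕ} (ρ : FramedGaloisRep K (PadicAlgCl ℓ) n)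
    (r : ∀ i, FramedGaloisRep K (PadicAlgCl ℓ) (m i)) (g : Field.absoluteGaloisGroup K)
    (h : ρ.charpoly g = ∏ i, (r i).charpoly g) : ∑ i, m i = n := by
  have hdeg := congrArg Polynomial.natDegree h
  rw [Polynomial.natDegree_prod_of_monic _ _ fun i _ => ?_] at hdeg
  · simp only [FramedRep.charpoly, Matrix.charpoly_natDegree_eq_dim, Fintype.card_fin] at hdeg
    exact hdeg.symm
  · exact Matrix.charpoly_monic _

/-- With at least two constituents of positive rank, each has rank `< n`. [folklore] -/
theorem rank_lt_of_two_le {n k : ℕ} {m : Fin k → ℕ} (hsum : ∑ i, m i = n) (hk : 2 ≤ k)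
    (hpos : ∀ i, 0 < m i) (i : Fin k) : m i < n := by
  obtain ⟨j, hj⟩ : ∃ j : Fin k, j ≠ i := by
    by_cases hi : (i : ℕ) = 0
    · exact ⟨⟨1, by omega⟩, fun h => by simp [Fin.ext_iff] at h; omega⟩
    · exact ⟨⟨0, by omega⟩, fun h => by simp [Fin.ext_iff] at h; omega⟩
  rw [← hsum]
  exact Finset.single_lt_sum hj (Finset.mem_univ _) (Finset.mem_univ _) (hpos j)
    fun k _ _ => Nat.zero_le _

/-- **The pointwise weak bootstrap** (Calegari–Gee 2013, §1.1; Ramakrishnan 2008, §0): granted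
Arthur–Clozel (2.2)–(2.3) for Borel–Jacquet data, if a cuspidal `π` on `GL_n(𝔸_K)` (`n ≥ 1`) has ONE
avatar `ρ₀` that is unramified almost everywhere, de Rham above `ℓ` for Fontaine's pinned datum and
Satake–Frobenius compatible with `(π, ι)` a.e., and if irreducible such representations of every rank
`0 < m < n` are weakly automorphic (a.e.-compatible with some cuspidal datum on `GL_m(𝔸_K)`), then every
`ρ : Γ_K → GL_n(ℚ̄_ℓ)` Satake–Frobenius compatible with `(π, ι)` a.e. is irreducible.
[cite: CalegariGee2013, §1.1] -/
theorem isIrreducible_of_geometric_of_weakAutomorphyBelow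
    (h22 : JacquetShalika1981_partialPairL_boundary_repData)
    (h23 : JacquetShalika1981_partialPairL_pole_repData)
    {K : Type} [Field K] [NumberField K] {n : ℕ} {hcpt : isCompact_glFiniteIntegralLevel n K}
    (hn : 0 < n) (π : CuspidalAutomorphicRepData n K hcpt) {ℓ : ℕ} [Fact ℓ.Prime]
    (ι : PadicAlgCl ℓ ≃+* ℂ) {ρ₀ : FramedGaloisRep K (PadicAlgCl ℓ) n}
    (hgeo₀ : (∀ᶠ v : HeightOneSpectrum (𝓞 K) in cofinite, ρ₀.IsUnramifiedAt v) ∧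
      ∀ (v : HeightOneSpectrum (𝓞 K)) (hv : ((ℓ : ℕ) : 𝓞 K) ∈ v.asIdeal),
        (Literature.NumberTheory.PAdicHodge.fontainePstAdicCompletion v ℓ hv).IsDeRhamFramed
          (ρ₀.toLocal v))
    (hρ₀ : ∀ᶠ v : HeightOneSpectrum (𝓞 K) in cofinite, SatakeFrobCompatibleAt ι π.1 ρ₀ v)
    (hBw : ∀ m : ℕ, 0 < m → m < n → ∀ (hm : isCompact_glFiniteIntegralLevel m K)
      (r : FramedGaloisRep K (PadicAlgCl ℓ) m), r.toGaloisRep.IsIrreducible →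
      ((∀ᶠ v : HeightOneSpectrum (𝓞 K) in cofinite, r.IsUnramifiedAt v) ∧
        ∀ (v : HeightOneSpectrum (𝓞 K)) (hv : ((ℓ : ℕ) : 𝓞 K) ∈ v.asIdeal),
          (Literature.NumberTheory.PAdicHodge.fontainePstAdicCompletion v ℓ hv).IsDeRhamFramed
            (r.toLocal v)) →
      ∃ σ : CuspidalAutomorphicRepData m K hm,
        ∀ᶠ v : HeightOneSpectrum (𝓞 K) in cofinite, SatakeFrobCompatibleAt ι σ.1 r v)
    (ρ : FramedGaloisRep K (PadicAlgCl ℓ) n)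
    (hρ : ∀ᶠ v : HeightOneSpectrum (𝓞 K) in cofinite, SatakeFrobCompatibleAt ι π.1 ρ v) :
    ρ.toGaloisRep.IsIrreducible := by
  suffices hirr₀ : ρ₀.toGaloisRep.IsIrreducible from
    isIrreducible_of_satakeFrobCompatible π.1 ι hirr₀ hρ₀ hρ
  -- the pinned-geometric constituents of `ρ₀` (14328 lead: P1 fed with D1)
  obtain ⟨k, m, r, -, hr, hchar, -, hone⟩ :=
    Summit.Langlands.Langlands.Theorems.ReciprocityUpToIrreducibility.exists_geometricConstituents
      Summit.Langlands.Langlands.Theorems.ReciprocityUpToIrreducibility.stub_deRhamBlocks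
      K ℓ ρ₀ hn hgeo₀
  by_cases hk1 : k = 1
  · exact hone hk1
  have hk2 : 2 ≤ k := by
    rcases Nat.lt_or_ge k 2 with hlt | hge
    · interval_cases k
      · -- `k = 0`: the empty product is `1`, but `det(X - ρ₀ 1)` has degree `n ≥ 1`
        have hsum := sum_rank_eq_of_charpoly_eq_prod ρ₀ r 1 (hchar 1)
        simp at hsum
        omega
      · exact absurd rfl hk1
    · exact hge
  have hsum : ∑ i, m i = n := sum_rank_eq_of_charpoly_eq_prod ρ₀ r 1 (hchar 1)
  have hlt : ∀ i, m i < n := rank_lt_of_two_le hsum hk2 fun i => (hr i).1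
  -- (B_w) below `n` makes every constituent weakly automorphic
  have hσ : ∀ i, ∃ σ : CuspidalAutomorphicRepData (m i) K
      (isCompact_glFiniteIntegralLevel_holds (m i) K),
      ∀ᶠ v : HeightOneSpectrum (𝓞 K) in cofinite, SatakeFrobCompatibleAt ι σ.1 (r i) v :=
    fun i => hBw (m i) (hr i).1 (hlt i) _ (r i) (hr i).2.1 (hr i).2.2
  choose σ hσc using hσ
  -- isobaric rigidity forbids `k ≥ 2`
  refine (isobaricRigidity_of_JS h22 h23 K n hcpt hn π k m
    (fun i => isCompact_glFiniteIntegralLevel_holds (m i) K) σ hk2 (fun i => (hr i).1) ?_).elim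
  have hall : ∀ᶠ v : HeightOneSpectrum (𝓞 K) in cofinite,
      ∀ i, SatakeFrobCompatibleAt ι (σ i).1 (r i) v :=
    Filter.eventually_all.mpr hσc
  filter_upwards [hρ₀, hall] with v hv hvi
  intro α hα
  obtain ⟨α₀, hα₀, -, hcp⟩ := hv
  obtain rfl : α = α₀ := AutomorphicRepData.hasSatakeParamAt_unique_holds π.1 hα hα₀
  choose β hβ _hurβ hcpβ using hvi
  refine ⟨β, hβ, ?_⟩
  -- the Frobenius polynomial of `ρ₀` is the product of those of the constituents
  have hprod : ρ₀.HasFrobCharpolyAt v (∏ i, arithFrobPolyOfSatake ι v.residueCard 1 (β i)) := by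
    intro 𝔓 h𝔓 τ hτ
    rw [hchar τ]
    exact Finset.prod_congr rfl fun i _ => hcpβ i 𝔓 h𝔓 τ hτ
  rw [← arithFrobPolyOfSatake_sum] at hprod
  have heq : arithFrobPolyOfSatake ι v.residueCard 1 α =
      arithFrobPolyOfSatake ι v.residueCard 1 (∑ i, β i) :=
    GaloisRep.HasFrobCharpolyAt.unique_holds
      ((FramedGaloisRep.hasFrobCharpolyAt_toGaloisRep_iff v _ ρ₀).mpr hcp)
      ((FramedGaloisRep.hasFrobCharpolyAt_toGaloisRep_iff v _ ρ₀).mpr hprod)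
  exact arithFrobPolyOfSatake_one_injective ι _ heq

/-- **Rank two**: if a cuspidal `π` on `GL_2(𝔸_K)` has one a.e.-unramified, de Rham (pinned datum)
avatar compatible with `(π, ι)` a.e., and pinned-geometric `ℓ`-adic CHARACTERS of `Γ_K` are weakly
automorphic on `GL_1(𝔸_K)`, then every `ρ : Γ_K → GL_2(ℚ̄_ℓ)` compatible with `(π, ι)` a.e. is
irreducible (granted Arthur–Clozel (2.2)–(2.3)). [cite: CalegariGee2013, §1.1] -/
theorem isIrreducible_rank_two_of_geometric_of_weakAutomorphy_one
    (h22 : JacquetShalika1981_partialPairL_boundary_repData)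
    (h23 : JacquetShalika1981_partialPairL_pole_repData)
    {K : Type} [Field K] [NumberField K] {hcpt : isCompact_glFiniteIntegralLevel 2 K}
    (π : CuspidalAutomorphicRepData 2 K hcpt) {ℓ : ℕ} [Fact ℓ.Prime]
    (ι : PadicAlgCl ℓ ≃+* ℂ) {ρ₀ : FramedGaloisRep K (PadicAlgCl ℓ) 2}
    (hgeo₀ : (∀ᶠ v : HeightOneSpectrum (𝓞 K) in cofinite, ρ₀.IsUnramifiedAt v) ∧
      ∀ (v : HeightOneSpectrum (𝓞 K)) (hv : ((ℓ : ℕ) : 𝓞 K) ∈ v.asIdeal),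
        (Literature.NumberTheory.PAdicHodge.fontainePstAdicCompletion v ℓ hv).IsDeRhamFramed
          (ρ₀.toLocal v))
    (hρ₀ : ∀ᶠ v : HeightOneSpectrum (𝓞 K) in cofinite, SatakeFrobCompatibleAt ι π.1 ρ₀ v)
    (hBw1 : ∀ (h1 : isCompact_glFiniteIntegralLevel 1 K) (r : FramedGaloisRep K (PadicAlgCl ℓ) 1),
      ((∀ᶠ v : HeightOneSpectrum (𝓞 K) in cofinite, r.IsUnramifiedAt v) ∧
        ∀ (v : HeightOneSpectrum (𝓞 K)) (hv : ((ℓ : ℕ) : 𝓞 K) ∈ v.asIdeal),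
          (Literature.NumberTheory.PAdicHodge.fontainePstAdicCompletion v ℓ hv).IsDeRhamFramed
            (r.toLocal v)) →
      ∃ σ : CuspidalAutomorphicRepData 1 K h1,
        ∀ᶠ v : HeightOneSpectrum (𝓞 K) in cofinite, SatakeFrobCompatibleAt ι σ.1 r v)
    (ρ : FramedGaloisRep K (PadicAlgCl ℓ) 2)
    (hρ : ∀ᶠ v : HeightOneSpectrum (𝓞 K) in cofinite, SatakeFrobCompatibleAt ι π.1 ρ v) :
    ρ.toGaloisRep.IsIrreducible := by
  refine isIrreducible_of_geometric_of_weakAutomorphyBelow h22 h23 two_pos π ι hgeo₀ hρ₀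
    (fun m hm hm2 hcm r _ hgeo => ?_) ρ hρ
  obtain rfl : m = 1 := by omega
  exact hBw1 hcm r hgeo

/-- **The route item `IrreducibleOffSector` from weak existence and weak automorphy** — both
VERBATIM the registered stubs `stub_weakExistence` (W) and `stub_weakAutomorphy` (B_w) of the 14328
lead's line for `ReciprocityUpToIrreducibility` — and Arthur–Clozel (2.2)–(2.3): the item's text
verbatim (structural form, for use inside the route's deciding theorem).  Compared with
`irreducibleOffSector_text_of_reciprocityUpToIrreducibility_text` (p103935) the local–global
compatibility clause and the reciprocity datum are gone. [cite: CalegariGee2013, §1.1] -/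
theorem irreducibleOffSector_text_of_weak
    (h22 : JacquetShalika1981_partialPairL_boundary_repData)
    (h23 : JacquetShalika1981_partialPairL_pole_repData)
    (hW : ∀ (K : Type) [Field K] [NumberField K] (n : ℕ) (hcpt : isCompact_glFiniteIntegralLevel n K), 0 < n → ∀ π : CuspidalAutomorphicRepData n K hcpt, π.1.IsLAlgebraic → ∀ (ℓ : ℕ) [Fact ℓ.Prime] (ι : PadicAlgCl ℓ ≃+* ℂ), ∃ ρ : FramedGaloisRep K (PadicAlgCl ℓ) n, ((∀ᶠ v : HeightOneSpectrum (𝓞 K) in cofinite, ρ.IsUnramifiedAt v) ∧ ∀ (v : HeightOneSpectrum (𝓞 K)) (hv : ((ℓ : ℕ) : 𝓞 K) ∈ v.asIdeal), (Literature.NumberTheory.PAdicHodge.fontainePstAdicCompletion v ℓ hv).IsDeRhamFramed (ρ.toLocal v)) ∧ ∀ᶠ v : HeightOneSpectrum (𝓞 K) in cofinite, SatakeFrobCompatibleAt ι π.1 ρ v)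
    (hBw : ∀ (K : Type) [Field K] [NumberField K] (n : ℕ) (hcpt : isCompact_glFiniteIntegralLevel n K), 0 < n → ∀ (ℓ : ℕ) [Fact ℓ.Prime] (ι : PadicAlgCl ℓ ≃+* ℂ) (ρ : FramedGaloisRep K (PadicAlgCl ℓ) n), ρ.toGaloisRep.IsIrreducible → ((∀ᶠ v : HeightOneSpectrum (𝓞 K) in cofinite, ρ.IsUnramifiedAt v) ∧ ∀ (v : HeightOneSpectrum (𝓞 K)) (hv : ((ℓ : ℕ) : 𝓞 K) ∈ v.asIdeal), (Literature.NumberTheory.PAdicHodge.fontainePstAdicCompletion v ℓ hv).IsDeRhamFramed (ρ.toLocal v)) → ∃ π : CuspidalAutomorphicRepData n K hcpt, π.1.IsLAlgebraic ∧ ∀ᶠ v : HeightOneSpectrum (𝓞 K) in cofinite, SatakeFrobCompatibleAt ι π.1 ρ v) :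
    ∀ (n : ℕ) (K : Type) [Field K] [NumberField K] (hcpt : Literature.NumberTheory.Automorphic.isCompact_glFiniteIntegralLevel n K), 0 < n → ∀ (π : Literature.NumberTheory.Automorphic.CuspidalAutomorphicRepData n K hcpt), π.1.IsLAlgebraic → ¬ (n = 3 ∧ NumberField.IsCMField K ∧ ∃ T : Literature.NumberTheory.Automorphic.InfinityType K n, π.1.HasInfinityType T ∧ T.IsRegular) → ∀ (ℓ : ℕ) [Fact ℓ.Prime] (ι : PadicAlgCl ℓ ≃+* ℂ) (ρ : Literature.NumberTheory.GaloisRepresentations.FramedGaloisRep K (PadicAlgCl ℓ) n), (∀ᶠ v : IsDedekindDomain.HeightOneSpectrum (NumberField.RingOfIntegers K) in cofinite, SatakeFrobCompatibleAt ι π.1 ρ v) → ρ.toGaloisRep.IsIrreducible := by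
  intro n K _ _ hcpt hn π hL _ ℓ _ ι ρ hρ
  obtain ⟨ρ₀, hgeo₀, hρ₀⟩ := hW K n hcpt hn π hL ℓ ι
  exact isIrreducible_of_geometric_of_weakAutomorphyBelow h22 h23 hn π ι hgeo₀ hρ₀
    (fun m hm _ hcm r hirr hgeo => (hBw K m hcm hm ℓ ι r hirr hgeo).imp fun _ h => h.2) ρ hρ

end Summit.Langlands.Langlands.Theorems.IrreducibleOffSector

end
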